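import Literature.Computability.Complexity.StackLists
import HarnessLib

/-!
# Streaming over coded lists on stack registers: item reader, token loops, counted loops

Trunk `CplxCore`, toolkit continuing `StackPrograms.lean` (`Com`, `Runs`), `StackArith.lean`
(`pour`, `clear`) and `StackLists.lean` (the list coding `encList [a₁, …, a_k] = dbl a₁ ++ 01 ++
dbl a₂ ++ 01 ++ …`, and `Com.emit`, which appends one coded element to a reversed output in time
`4 |a| + 3`). The decoders of those files (`unpairW`, `StackItemLists.popItem`) split off the
first element by a pass over the WHOLE register, so that a traversal of a list of `N` elements
costs `Θ(N · |code|)`; exponential-size tables traversed `poly(n)` times (the truth-table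
algorithms of Williams' `ACC`-SAT procedure: Yates' zeta transform, radix sorting; Williams
2014, §4 and App. C) need the streaming discipline of multitape machines instead — every element
is read in time proportional to its own length. This file provides it:

* `Com.readItem L A w` / **`runs_readItem`**: remove the first element `dbl v ++ 01` of the list
  in `L`, leaving `vʳ` on top of `A`, in `8 |v| + 8` steps whatever follows in `L` (a loop on
  the *token register* `w`, refilled after every payload pair `bb` and not after the separator
  `01`); `readItemTo` (payload in order, via a scratch register), `skipItem`, and the empty case
  `runs_readItem_nil`;
* `Com.streamLoop L w body` / **`runs_streamLoop`**: `while L ≠ [] do body` as a token loop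
  (`retoken` peeks at `L`), with the rule: if the body, from any state abstracted by the list
  `a :: l` of unread elements (invariant `P`, `L = code (a :: l)`), consumes one element within
  `c a` steps re-establishing the invariant at `l`, then the loop ends in the invariant at `[]`
  within `Σ c + 6 |l| + 4` steps — the shape in which the passes of a table algorithm are
  specified (one functional step per element, cost per element);
* `Com.ifNonempty L c₁ c₂` (branch on emptiness, register restored) and `Com.countLoop U body` /
  **`runs_countLoop`** (run the body once per token of a unary counter: blocks of `2^j`
  consecutive elements, fixed-width fields).

All effects are stated in frame style over an arbitrary register type (final file as an update
of the initial one, or through a caller-chosen invariant), so that they instantiate in any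
register bank.

## References

* R. Williams, *Nonuniform ACC circuit lower bounds*, J. ACM 61(1) (2014), App. C (streaming
  implementation of the evaluation lemma on multitape machines) [Williams2014].
* S. Arora, B. Barak, *Computational Complexity: A Modern Approach*, CUP 2009, §0.1
  (self-delimiting codes of tuples), §1.3 [AroraBarak2009].
* T. Nipkow, G. Klein, *Concrete Semantics with Isabelle/HOL*, Springer 2014, §7.2 (big-step
  rules for loops; rule induction) — the verification style of `StackPrograms.lean`.
-/

namespace Literature.Computability.Complexity

open SProg

namespace Com

variable {ι : Type} [DecidableEq ι]

/-- The coding of a nonempty list starts with the first element's item `dbl a ++ 01` (the form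
read by `Com.readItem`). [folklore] -/
theorem encList_cons_eq_dbl (a : List Bool) (l : List (List Bool)) :
    encList (a :: l) = dbl a ++ false :: true :: encList l := by
  rw [encList_eq_flatMap, encList_eq_flatMap, List.flatMap_cons]
  simp [dbl]

/-- A nonempty list has a nonempty code. [folklore] -/
theorem encList_cons_ne_nil (a : List Bool) (l : List (List Bool)) : encList (a :: l) ≠ [] := by
  rw [encList_cons_eq_dbl]; simp

/-- After a pass emitting the elements `E` onto `o` (`o = outRev E`), pouring `o` onto a register
yields the forward code `encList E` on top of it (`reverse_outRev`, `runs_pour`). [folklore] -/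
theorem reverse_outRev_append (E : List (List Bool)) (d : List Bool) :
    (outRev E).reverse ++ d = encList E ++ d := by rw [reverse_outRev]


/-! ### Reading one item in time proportional to the item -/

/-- The body of the item reader: pop two bits of `L`; an equal pair `bb` is a payload bit
(pushed on `A`, and a token is put back on `w` to continue); the separator `01`, a malformed
`10`, or the end of `L` stop the loop (no token). [folklore] -/
def readItemBody (L A w : ι) : Com ι :=
  pop L
    (pop L (push A true ;; push w true) skip skip)
    (pop L skip (push A false ;; push w true) skip)
    skip

/-- `readItem L A w`: remove the first item `dbl v ++ [0, 1]` of the coded list in `L`, leaving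
the payload `v` REVERSED on top of `A`; `w` is the token register of the loop (empty before and
after). Time `8 |v| + 8`, independent of the rest of `L`. [folklore] -/
def readItem (L A w : ι) : Com ι := push w true ;; loop w (readItemBody L A w) skip

/-- The reader loop from one token: consumes the item, `8 |v| + 7` steps. [folklore] -/
theorem runs_readItemLoop {L A w : ι} (hLA : L ≠ A) (hLw : L ≠ w) (hAw : A ≠ w) :
    ∀ (v : List Bool) (rest : List Bool) (R : Regs ι),
      R L = dbl v ++ false :: true :: rest → R w = [true] →
      Runs (loop w (readItemBody L A w) skip) R
        (Function.update (Function.update (Function.update R w []) L rest) A (v.reverse ++ R A))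
        (8 * v.length + 7)
  | [], rest, R, hL, hw => by
    rw [dbl_nil, List.nil_append] at hL
    -- body: pop `0`, pop `1`, stop
    have hb : Runs (readItemBody L A w) (Function.update R w [])
        (Function.update (Function.update R w []) L rest) 4 := by
      refine Runs.pop_false _ _ (w := true :: rest) (by simp only [Function.update_apply]; split_ifs <;> simp_all) ?_
      refine (Runs.pop_true _ _ (w := rest) (by simp) (Runs.skip _)).of_eq ?_ (by rfl)
      ext i : 1; simp only [Function.update_apply]; split_ifs <;> simp_all
    have hexit : Runs (loop w (readItemBody L A w) skip)
        (Function.update (Function.update R w []) L rest)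
        (Function.update (Function.update R w []) L rest) 1 :=
      Runs.loop_nil _ _ (by simp only [Function.update_apply]; split_ifs <;> simp_all)
    refine (Runs.loop_true hw hb hexit).of_eq ?_ (by rfl)
    ext i : 1; simp only [Function.update_apply]; split_ifs <;> simp_all
  | b :: v, rest, R, hL, hw => by
    rw [dbl_cons] at hL
    set R₁ : Regs ι := Function.update (Function.update (Function.update (Function.update R w [])
      L (dbl v ++ false :: true :: rest)) A (b :: R A)) w [true] with hR₁
    have hb : Runs (readItemBody L A w) (Function.update R w []) R₁ 6 := by
      cases b with
      | true =>
        refine Runs.pop_true _ _ (w := true :: (dbl v ++ false :: true :: rest))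
          (by simp only [Function.update_apply]; split_ifs <;> simp_all) ?_
        refine Runs.pop_true _ _ (w := dbl v ++ false :: true :: rest) (by simp) ?_
        refine ((Runs.push A true _).seq (Runs.push w true _)).of_eq ?_ (by rfl)
        rw [hR₁]
        ext i : 1; simp only [Function.update_apply]; split_ifs <;> simp_all
      | false =>
        refine Runs.pop_false _ _ (w := false :: (dbl v ++ false :: true :: rest))
          (by simp only [Function.update_apply]; split_ifs <;> simp_all) ?_
        refine Runs.pop_false _ _ (w := dbl v ++ false :: true :: rest) (by simp) ?_
        refine ((Runs.push A false _).seq (Runs.push w true _)).of_eq ?_ (by rfl)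
        rw [hR₁]
        ext i : 1; simp only [Function.update_apply]; split_ifs <;> simp_all
    have ih := runs_readItemLoop hLA hLw hAw v rest R₁
      (by rw [hR₁]; simp only [Function.update_apply]; split_ifs <;> simp_all)
      (by rw [hR₁]; simp)
    refine (Runs.loop_true hw hb ih).of_eq ?_ ?_
    · rw [hR₁]
      ext i : 1; simp only [Function.update_apply]; split_ifs <;> simp_all
    · simp; omega

/-- **The item reader.** From `L = dbl v ++ 01 ++ rest` and `w` empty, `readItem L A w` leaves
`L = rest`, `A := vʳ ++ A`, everything else unchanged, within `8 |v| + 8` steps. [folklore] -/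
theorem runs_readItem {L A w : ι} (hLA : L ≠ A) (hLw : L ≠ w) (hAw : A ≠ w) (v rest : List Bool)
    (R : Regs ι) (hL : R L = dbl v ++ false :: true :: rest) (hw : R w = []) :
    Runs (readItem L A w) R
      (Function.update (Function.update R L rest) A (v.reverse ++ R A)) (8 * v.length + 8) := by
  have h1 : Runs (push w true) R (Function.update R w [true]) 1 := Runs.push' (by rw [hw])
  have h2 := runs_readItemLoop hLA hLw hAw v rest (Function.update R w [true])
    (by simp only [Function.update_apply]; split_ifs <;> simp_all) (by simp)
  refine (h1.seq h2).of_eq ?_ (by omega)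
  ext i : 1; simp only [Function.update_apply]; split_ifs <;> simp_all

/-- On an empty list the reader does nothing (in `6` steps). [folklore] -/
theorem runs_readItem_nil {L A w : ι} (hLw : L ≠ w) (R : Regs ι) (hL : R L = []) (hw : R w = []) :
    Runs (readItem L A w) R R 6 := by
  have h1 : Runs (push w true) R (Function.update R w [true]) 1 := Runs.push' (by rw [hw])
  have hb : Runs (readItemBody L A w) (Function.update (Function.update R w [true]) w []) R 2 := by
    refine (Runs.pop_nil _ _ (by simp only [Function.update_apply]; split_ifs <;> simp_all) (Runs.skip _)).of_eq ?_
      (by rfl)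
    ext i : 1; simp only [Function.update_apply]; split_ifs <;> simp_all
  have hexit : Runs (loop w (readItemBody L A w) skip) R R 1 := Runs.loop_nil _ _ hw
  have h2 := Runs.loop_true (R := Function.update R w [true]) (by simp) hb hexit
  exact (h1.seq h2).of_eq rfl (by omega)

/-! ### Token loops over the items of a coded list -/

/-- `retoken L w`: put one token on `w` iff `L` is nonempty (peek at `L` by popping its top bit
and pushing it back). [folklore] -/
def retoken (L w : ι) : Com ι :=
  pop L (push L true ;; push w true) (push L false ;; push w true) skip

/-- `retoken` on a nonempty `L`: a token, `4` steps. [folklore] -/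
theorem runs_retoken_cons {L w : ι} (hLw : L ≠ w) (R : Regs ι) {b : Bool} {rest : List Bool}
    (hL : R L = b :: rest) : Runs (retoken L w) R (Function.update R w (true :: R w)) 4 := by
  cases b with
  | true =>
    refine Runs.pop_true _ _ hL ?_
    refine ((Runs.push L true _).seq (Runs.push w true _)).of_eq ?_ (by rfl)
    ext i : 1; simp only [Function.update_apply]; split_ifs <;> simp_all
  | false =>
    refine Runs.pop_false _ _ hL ?_
    refine ((Runs.push L false _).seq (Runs.push w true _)).of_eq ?_ (by rfl)
    ext i : 1; simp only [Function.update_apply]; split_ifs <;> simp_all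

/-- `retoken` on an empty `L`: nothing, `2` steps. [folklore] -/
theorem runs_retoken_nil {L w : ι} (R : Regs ι) (hL : R L = []) : Runs (retoken L w) R R 2 :=
  Runs.pop_nil _ _ hL (Runs.skip _)

/-- `streamLoop L w body`: **`while L ≠ [] do body`**, as a token loop on the register `w`
(empty outside the loop): the body is run as long as the list register `L` is nonempty, and is
expected to consume exactly one item of `L` per round. [folklore] -/
def streamLoop (L w : ι) (body : Com ι) : Com ι :=
  retoken L w ;; loop w (body ;; retoken L w) skip

/-- The token loop from a state with one pending token and a nonempty list. [folklore] -/
theorem runs_streamLoop_aux {L w : ι} {body : Com ι} {α : Type} (code : List α → List Bool)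
    (hnil : code [] = []) (hcons : ∀ a l, code (a :: l) ≠ [])
    (P : List α → Regs ι → Prop) (c : α → ℕ)
    (hbody : ∀ (a : α) (l : List α) (R : Regs ι), P (a :: l) R → R L = code (a :: l) →
      R w = [] → ∃ R', Runs body R R' (c a) ∧ R' L = code l ∧ R' w = [] ∧ P l R') :
    ∀ (l : List α) (a : α) (R : Regs ι), P (a :: l) R → R L = code (a :: l) → R w = [] →
      ∃ R', Runs (loop w (body ;; retoken L w) skip) (Function.update R w [true]) R'
          (((a :: l).map c).sum + 6 * (l.length + 1)) ∧
        R' L = [] ∧ R' w = [] ∧ P [] R'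
  | [], a, R, hP, hL, hw => by
    obtain ⟨R₁, hb, hL₁, hw₁, hP₁⟩ := hbody a [] R hP hL hw
    rw [hnil] at hL₁
    have hR : Function.update (Function.update R w [true]) w [] = R := by
      rw [Function.update_idem, Function.update_eq_self_iff]; exact hw.symm
    have h1 : Runs (body ;; retoken L w) (Function.update (Function.update R w [true]) w []) R₁
        (c a + 2) := by
      rw [hR]
      exact hb.seq (runs_retoken_nil R₁ hL₁)
    refine ⟨R₁, (Runs.loop_true (by simp) h1 (Runs.loop_nil _ _ hw₁)).mono ?_, hL₁, hw₁, hP₁⟩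
    simp only [List.map_cons, List.map_nil, List.sum_cons, List.sum_nil, List.length_nil]
    omega
  | b :: l, a, R, hP, hL, hw => by
    obtain ⟨R₁, hb, hL₁, hw₁, hP₁⟩ := hbody a (b :: l) R hP hL hw
    obtain ⟨d, rest, hd⟩ : ∃ d rest, code (b :: l) = d :: rest := by
      cases h : code (b :: l) with
      | nil => exact absurd h (hcons b l)
      | cons d rest => exact ⟨d, rest, rfl⟩
    have hR : Function.update (Function.update R w [true]) w [] = R := by
      rw [Function.update_idem, Function.update_eq_self_iff]; exact hw.symm
    have h1 : Runs (body ;; retoken L w) (Function.update (Function.update R w [true]) w [])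
        (Function.update R₁ w [true]) (c a + 4) := by
      rw [hR]
      have h2 := runs_retoken_cons (L := L) (w := w) (b := d) (rest := rest) (by
        rintro rfl; exact hcons b l (by rw [← hL₁, hw₁])) R₁ (by rw [hL₁, hd])
      rw [hw₁] at h2
      exact hb.seq h2
    obtain ⟨R', hloop, hL', hw', hP'⟩ :=
      runs_streamLoop_aux code hnil hcons P c hbody l b R₁ hP₁ hL₁ hw₁
    refine ⟨R', (Runs.loop_true (by simp) h1 hloop).of_eq rfl ?_, hL', hw', hP'⟩
    simp only [List.map_cons, List.sum_cons, List.length_cons]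
    omega

/-- **The stream-loop rule.** Suppose the items still to be processed are abstracted by a list
`l : List α` with `L` holding `code l` (`code [] = []`, `code (a :: l) ≠ []`), and that from any
state satisfying `P (a :: l)` with `w` empty the body runs within `c a` steps to a state
satisfying `P l`, having consumed the item (`L = code l`) and left `w` empty. Then from a state
satisfying `P l` the loop runs within `Σ c + 6 |l| + 4` steps to a state satisfying `P []` with
`L` and `w` empty. [folklore] -/
theorem runs_streamLoop {L w : ι} (hLw : L ≠ w) {body : Com ι} {α : Type}
    (code : List α → List Bool) (hnil : code [] = []) (hcons : ∀ a l, code (a :: l) ≠ [])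
    (P : List α → Regs ι → Prop) (c : α → ℕ)
    (hbody : ∀ (a : α) (l : List α) (R : Regs ι), P (a :: l) R → R L = code (a :: l) →
      R w = [] → ∃ R', Runs body R R' (c a) ∧ R' L = code l ∧ R' w = [] ∧ P l R')
    (l : List α) (R : Regs ι) (hP : P l R) (hL : R L = code l) (hw : R w = []) :
    ∃ R', Runs (streamLoop L w body) R R' ((l.map c).sum + 6 * l.length + 4) ∧
      R' L = [] ∧ R' w = [] ∧ P [] R' := by
  cases l with
  | nil =>
    rw [hnil] at hL
    exact ⟨R, ((runs_retoken_nil R hL).seq (Runs.loop_nil _ _ hw)).mono (by simp), hL, hw, hP⟩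
  | cons a l =>
    obtain ⟨d, rest, hd⟩ : ∃ d rest, code (a :: l) = d :: rest := by
      cases h : code (a :: l) with
      | nil => exact absurd h (hcons a l)
      | cons d rest => exact ⟨d, rest, rfl⟩
    have h1 := runs_retoken_cons hLw R (b := d) (rest := rest) (by rw [hL, hd])
    rw [hw] at h1
    obtain ⟨R', hloop, hL', hw', hP'⟩ := runs_streamLoop_aux code hnil hcons P c hbody l a R hP hL hw
    refine ⟨R', (h1.seq hloop).of_eq rfl ?_, hL', hw', hP'⟩
    simp only [List.map_cons, List.sum_cons, List.length_cons]
    omega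

/-! ### Derived readers -/

/-- `readItemTo L A w t`: remove the first item of `L` and put its payload IN ORDER on top of
`A` (read it reversed onto the empty scratch `t`, then pour). [folklore] -/
def readItemTo (L A w t : ι) : Com ι := readItem L t w ;; pour t A

/-- Effect of `readItemTo`: `L = rest`, `A := v ++ A`, within `11 |v| + 9` steps. [folklore] -/
theorem runs_readItemTo {L A w t : ι} (hLA : L ≠ A) (hLw : L ≠ w) (hLt : L ≠ t) (hAt : A ≠ t)
    (htw : t ≠ w) (v rest : List Bool) (R : Regs ι)
    (hL : R L = dbl v ++ false :: true :: rest) (hw : R w = []) (ht : R t = []) :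
    Runs (readItemTo L A w t) R
      (Function.update (Function.update R L rest) A (v ++ R A)) (11 * v.length + 9) := by
  have h1 := runs_readItem hLt hLw htw v rest R hL hw
  have h2 := runs_pour hAt.symm (Function.update (Function.update R L rest) t (v.reverse ++ R t))
  refine (h1.seq h2).of_eq ?_ ?_
  · ext i : 1; simp only [Function.update_apply]; split_ifs <;> simp_all
  · simp [ht]; omega

/-- `skipItem L w t`: drop the first item of `L` (read it onto the empty scratch `t`, clear `t`).
[folklore] -/
def skipItem (L w t : ι) : Com ι := readItem L t w ;; clear t

/-- Effect of `skipItem`: `L = rest`, within `10 |v| + 9` steps. [folklore] -/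
theorem runs_skipItem {L w t : ι} (hLw : L ≠ w) (hLt : L ≠ t) (htw : t ≠ w) (v rest : List Bool)
    (R : Regs ι) (hL : R L = dbl v ++ false :: true :: rest) (hw : R w = []) (ht : R t = []) :
    Runs (skipItem L w t) R (Function.update R L rest) (10 * v.length + 9) := by
  have h1 := runs_readItem hLt hLw htw v rest R hL hw
  have h2 := runs_clear t (Function.update (Function.update R L rest) t (v.reverse ++ R t))
  refine (h1.seq h2).of_eq ?_ ?_
  · ext i : 1; simp only [Function.update_apply]; split_ifs <;> simp_all
  · simp [ht]; omega

/-! ### Branching on emptiness -/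

/-- `ifNonempty L c₁ c₂`: run `c₁` if register `L` is nonempty (peeking at its top bit), `c₂`
otherwise. [folklore] -/
def ifNonempty (L : ι) (c₁ c₂ : Com ι) : Com ι :=
  pop L (push L true ;; c₁) (push L false ;; c₁) c₂

/-- `ifNonempty` on a nonempty register. [folklore] -/
theorem runs_ifNonempty_cons {L : ι} {c₁ : Com ι} (c₂ : Com ι) {R R' : Regs ι} {b : Bool}
    {rest : List Bool} {B : ℕ} (hL : R L = b :: rest) (h : Runs c₁ R R' B) :
    Runs (ifNonempty L c₁ c₂) R R' (B + 3) := by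
  have hR : Function.update (Function.update R L rest) L (b :: rest) = R := by
    rw [Function.update_idem, Function.update_eq_self_iff]; exact hL.symm
  cases b with
  | true =>
    have h' : Runs c₁ (Function.update (Function.update R L rest) L
        (true :: Function.update R L rest L)) R' B := by
      rw [Function.update_self, hR]; exact h
    exact (Runs.pop_true _ _ hL ((Runs.push L true _).seq h')).of_eq rfl (by omega)
  | false =>
    have h' : Runs c₁ (Function.update (Function.update R L rest) L
        (false :: Function.update R L rest L)) R' B := by
      rw [Function.update_self, hR]; exact h
    exact (Runs.pop_false _ _ hL ((Runs.push L false _).seq h')).of_eq rfl (by omega)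

/-- `ifNonempty` on an empty register. [folklore] -/
theorem runs_ifNonempty_nil {L : ι} (c₁ : Com ι) {c₂ : Com ι} {R R' : Regs ι} {B : ℕ}
    (hL : R L = []) (h : Runs c₂ R R' B) : Runs (ifNonempty L c₁ c₂) R R' (B + 2) :=
  Runs.pop_nil _ _ hL h

/-! ### Counted loops on a unary register -/

/-- `countLoop U body`: run `body` once per token of the unary counter `U` (consumed; a body
that wants to keep the count parks one token per round on a register of its own). [folklore] -/
def countLoop (U : ι) (body : Com ι) : Com ι := loop U body body

/-- **The counted-loop rule.** If from any state satisfying `P (k + 1)` whose counter held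
`k + 1` tokens the body, started after the pop, runs within `c` steps to a state satisfying
`P k` with the counter at `k` tokens, then from `P k` with `U = 1ᵏ` the loop reaches `P 0` with
`U` empty within `k (c + 2) + 1` steps. [folklore] -/
theorem runs_countLoop {U : ι} {body : Com ι} (P : ℕ → Regs ι → Prop) (c : ℕ)
    (hbody : ∀ (k : ℕ) (R : Regs ι), P (k + 1) R → R U = List.replicate (k + 1) true →
      ∃ R', Runs body (Function.update R U (List.replicate k true)) R' c ∧
        R' U = List.replicate k true ∧ P k R') :
    ∀ (k : ℕ) (R : Regs ι), P k R → R U = List.replicate k true →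
      ∃ R', Runs (countLoop U body) R R' (k * (c + 2) + 1) ∧ R' U = [] ∧ P 0 R'
  | 0, R, hP, hU => ⟨R, (Runs.loop_nil _ _ hU).of_eq rfl (by simp), hU, hP⟩
  | k + 1, R, hP, hU => by
    obtain ⟨R₁, hb, hU₁, hP₁⟩ := hbody k R hP hU
    obtain ⟨R', hloop, hU', hP'⟩ := runs_countLoop P c hbody k R₁ hP₁ hU₁
    refine ⟨R', (Runs.loop_true (w := List.replicate k true) (by rw [hU, List.replicate_succ])
      hb hloop).of_eq rfl ?_, hU', hP'⟩
    rw [Nat.succ_mul]; omega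

end Com

end Literature.Computability.Complexity
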